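import Literature.Geometry.Kaehler.ComplexTorusAndreAdjointInvolution
import HarnessLib

/-!
# The Poincaré transpose `ᵗu` and André's involution `u† := *_H ᵗu *_H` (his `u′`, Kleiman's `u'`) as OPERATIONS on `End H•(X; ℂ)`:
# `ᵗ(uv) = ᵗv ᵗu`, `ᵗᵗu = u` on operators commuting with the Weil operator, `ᵗL_η = L_η`, `ᵗC = C⁻¹`; `(uv)′ = v′u′`, `u″ = u`,
# `L_η′ = Λ_η`, `Λ_η′ = L_η`; `⟨u′ x, y⟩_H = ⟨x, u y⟩_H` and `Tr(u u′) > 0` for real `C`-commuting `u ≠ 0`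

Layer `Literature/Geometry/Kaehler`, namespace `Literature.Geometry.Kaehler.ComplexTorus`; lane `lit-hodgefound` (Track 2 foundations library),
prover seat `lit-hodgefound-p35` (generation 52, row g52-#4; sequel of rows g52-#2 `ComplexTorusAndreTransposePositivity` and g52-#3
`ComplexTorusAndreAdjointInvolution`, which state everything for a GIVEN transpose `hadj : IsAdjointPair B_e B_e u ᵗu`). TWO DEFINITIONS WITH BODIES
(`poincareTranspose`, `andreDagger`) + theorems; no named fact, no instance, no notation; D-0026 net debt `0`.

THE POINT. Rows g52-#2/#3 take the Poincaré transpose as a hypothesis. Since `B_e` is non-degenerate on the finite-dimensional `H•(X; ℂ)`, every operator HAS a unique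
right transpose; THIS FILE names it — `poincareTranspose Φ e u = ᵗu`, Mathlib's `leftAdjointOfNondegenerate` for the flipped form — and André's `u′ := *_H ᵗu *_H` —
`andreDagger Φ hη e u` — so that `ᵗ` and `′` become honest (anti-multiplicative, additive, unital) self-maps of the algebra `End H•(X; ℂ)`, involutive on the subalgebra of
operators commuting with the Weil operator `C`, with `L_η′ = Λ_η` and `Λ_η′ = L_η` ("`*_H L *_H = ᶜΛ`"), and the adjunction / positivity / symmetry of rows g52-#2/#3 read
without the transpose hypothesis. Row g52-#5 puts the resulting `StarRing` structure on the real `C`-commuting operators and deduces André's Prop. 3.3 /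
Remarque 1: that algebra is semisimple.

## What is defined / proved (`B = poincarePairingG Φ e`, `C = rotG E (π/2)`, `*_H = (hasLefschetzProperty_lefschetzG hη).andreHodgeInvolution isZGrading_countingG (finrank ℂ E)`)

* §1 **def `poincareTranspose Φ e u`** (`ᵗu`): `isAdjointPair_poincareTranspose` (`B(u x, y) = B(x, ᵗu y)`), **`poincareTranspose_eq_of_isAdjointPair`** (uniqueness),
  `poincareTranspose_one`, `poincareTranspose_zero`, `poincareTranspose_add`, `poincareTranspose_smul`, **`poincareTranspose_mul`** (`ᵗ(uv) = ᵗv ᵗu`),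
  **`poincareTranspose_poincareTranspose`** (`ᵗᵗu = u` for `[C, u] = 0`), `poincareTranspose_rotG` (`ᵗ(e^{iθ})^* = (e^{−iθ})^*`), `poincareTranspose_lefschetzG` (`ᵗL = L`),
  `poincareTranspose_lefschetzDualG` (`ᵗΛ = Λ`), `poincareTranspose_weylOperator` (`ᵗw = w`), `poincareTranspose_andreHodgeInvolution` (`ᵗ*_H = *_H`),
  `conjG_poincareTranspose_apply` (`ᵗu` real for `u` real), `commute_rotG_pi_div_two_poincareTranspose` (`[C, ᵗu] = 0` for `[C, u] = 0`), `trace_poincareTranspose`.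
* §2 **def `andreDagger Φ hη e u = *_H ᵗu *_H`**: `andreDagger_one`, `andreDagger_zero`, `andreDagger_add`, `andreDagger_smul`, **`andreDagger_mul`** (`(uv)′ = v′u′`),
  **`andreDagger_andreDagger`** (`u″ = u` for `[C, u] = 0`), **`andreDagger_lefschetzG`** (`L_η′ = Λ_η`), **`andreDagger_lefschetzDualG`** (`Λ_η′ = L_η`), `andreDagger_andreHodgeInvolution`
  (`*_H′ = *_H`), `conjG_andreDagger_apply`, `commute_rotG_pi_div_two_andreDagger`, `trace_andreDagger` (`Tr u′ = Tr u`).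
* §3 **`andreHodgeMetric_andreDagger_left`** (`⟨u′ x, y⟩_H = ⟨x, u y⟩_H`), `andreHodgeMetric_andreDagger_right`, **`exists_pos_trace_mul_andreDagger`** (`Tr(u u′) > 0`, `u ≠ 0` real
  `C`-commuting), `trace_mul_andreDagger_eq_zero_iff`, **`trace_mul_andreDagger_comm`** (`Tr(u v′) = Tr(v u′)`), `conj_trace_mul_andreDagger_self` (`Tr(u v′) ∈ ℝ`).

## Sources, VERBATIM

* Y. André, *Pour une théorie inconditionnelle des motifs*, Publ. Math. IHÉS **83** (1996) [Andre1996Motifs], held `paper:doi-10-1007-bf02698643`: §1.1 (p. 10 = chunk p0007)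
  "`*_H L *_H = ᶜΛ`" and (p. 11 = chunk p0008 L12–L14) "`L`, `*_L`, `*_H` et `ᶜΛ` sont auto-adjoints relativement à l'accouplement de dualité de Poincaré"; Prop. 2.3 (p. 16)
  "stable par transposition"; Prop. 3.3 (p. 21 = chunk p0018 L33–L38) "la forme bilinéaire symétrique sur `C⁰_mot(X, X)` donnée par `(u, v) ↦ Tr_{H(X)}(u *_H ᵗv *_H)` est à valeurs
  dans `ℚ`, et définie positive"; Appendice Remarque 1 (p. 47 = chunk p0044 L5–L8) "on peut faire agir l'involution `′` sur `End M` par transport de structure".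
* S. L. Kleiman, *Algebraic cycles and the Weil conjectures* (1968) [Kleiman1968AlgebraicCycles], §3 Thm. 3.11 (the involution `u ↦ u'`; cited through André).
* N. Bourbaki, *Algebra I* (1989) [BourbakiAlgebraI1989], Ch. III §9 / Ch. II §4 no. 3 (the transpose with respect to a non-degenerate bilinear form: existence, uniqueness,
  `ᵗ(uv) = ᵗv ᵗu`, `Tr ᵗu = Tr u`).
* D. Huybrechts, *Complex Geometry* (2005) [Huybrechts2005], §1.2 Exercise 1.2.3 ("`[L, 𝐈] = [Λ, 𝐈] = 0`"), Remark 1.2.19 (i).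

## Scope / not here

The `StarRing` structure on the real `C`-commuting operators and the semisimplicity (André Prop. 3.3 first clause / Remarque 1) are row g52-#5.
-/

noncomputable section

namespace Literature.Geometry.Kaehler

namespace ComplexTorus

open Module Function Finset
open Literature.LinearAlgebra.Alternating Literature.Algebra.Lie Literature.Analysis.Complex

set_option maxSynthPendingDepth 3

universe uE

variable {ι : Type*} [Fintype ι] [DecidableEq ι] {E : Type uE} [NormedAddCommGroup E] [NormedSpace ℂ E] [FiniteDimensional ℂ E]
  (Φ : (ι → ℝ) ≃L[ℝ] E) {η : E [⋀^Fin 2]→L[ℝ] ℝ} {N : ℕ}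

/-! ## §1 The Poincaré transpose as an operation -/

section Transpose

/-- **The (right) Poincaré transpose `ᵗu` of an operator `u` on `H•(X; ℂ)`**: the unique operator with `B_e(u x, y) = B_e(x, ᵗu y)` for the graded Poincaré
pairing `B_e` — Mathlib's left adjoint of `u` for the flipped form `B_e.flip`, which exists since `B_e` is non-degenerate on the finite-dimensional `H•(X; ℂ)`; André's
"transposition" `u ↦ ᵗu`. [cite: Andre1996Motifs, Prop. 2.3 (p. 16), Prop. 3.3 (p. 21)] [cite: BourbakiAlgebraI1989, Ch. III §9] -/
def poincareTranspose (e : Fin N ≃ ι) (T : Module.End ℂ (GForm E ℂ)) : Module.End ℂ (GForm E ℂ) :=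
  (poincarePairingG Φ e).flip.leftAdjointOfNondegenerate (poincarePairingG_nondegenerate Φ e).flip T

/-- **`B_e(u x, y) = B_e(x, ᵗu y)`.** [cite: BourbakiAlgebraI1989, Ch. III §9] [cite: Andre1996Motifs, Prop. 3.3 (p. 21)] -/
theorem isAdjointPair_poincareTranspose (e : Fin N ≃ ι) (T : Module.End ℂ (GForm E ℂ)) :
    LinearMap.IsAdjointPair (poincarePairingG Φ e) (poincarePairingG Φ e) T (poincareTranspose Φ e T) := fun x y ↦
  ((poincarePairingG Φ e).flip.isAdjointPairLeftAdjointOfNondegenerate (poincarePairingG_nondegenerate Φ e).flip T y x).symm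

/-- **UNIQUENESS: any right transpose IS `ᵗu`** (`B_e` non-degenerate). [cite: BourbakiAlgebraI1989, Ch. III §9] -/
theorem poincareTranspose_eq_of_isAdjointPair (e : Fin N ≃ ι) {T Tt : Module.End ℂ (GForm E ℂ)}
    (hadj : LinearMap.IsAdjointPair (poincarePairingG Φ e) (poincarePairingG Φ e) T Tt) : poincareTranspose Φ e T = Tt :=
  (poincarePairingG Φ e).flip.isAdjointPair_unique_of_nondegenerate (poincarePairingG_nondegenerate Φ e).flip T _ _
    (fun x y ↦ (isAdjointPair_poincareTranspose Φ e T y x).symm) (fun x y ↦ (hadj y x).symm)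

/-- `ᵗ1 = 1`. [cite: BourbakiAlgebraI1989, Ch. III §9] -/
theorem poincareTranspose_one (e : Fin N ≃ ι) : poincareTranspose Φ e 1 = 1 :=
  poincareTranspose_eq_of_isAdjointPair Φ e fun _ _ ↦ rfl

/-- `ᵗ0 = 0`. [cite: BourbakiAlgebraI1989, Ch. III §9] -/
theorem poincareTranspose_zero (e : Fin N ≃ ι) : poincareTranspose Φ e 0 = 0 :=
  poincareTranspose_eq_of_isAdjointPair Φ e fun _ _ ↦ by rw [LinearMap.zero_apply, LinearMap.zero_apply, map_zero, map_zero, LinearMap.zero_apply]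

/-- `ᵗ(u + v) = ᵗu + ᵗv`. [cite: BourbakiAlgebraI1989, Ch. III §9] -/
theorem poincareTranspose_add (e : Fin N ≃ ι) (S T : Module.End ℂ (GForm E ℂ)) :
    poincareTranspose Φ e (S + T) = poincareTranspose Φ e S + poincareTranspose Φ e T :=
  poincareTranspose_eq_of_isAdjointPair Φ e ((isAdjointPair_poincareTranspose Φ e S).add (isAdjointPair_poincareTranspose Φ e T))

/-- `ᵗ(c u) = c ᵗu`. [cite: BourbakiAlgebraI1989, Ch. III §9] -/
theorem poincareTranspose_smul (e : Fin N ≃ ι) (c : ℂ) (T : Module.End ℂ (GForm E ℂ)) :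
    poincareTranspose Φ e (c • T) = c • poincareTranspose Φ e T :=
  poincareTranspose_eq_of_isAdjointPair Φ e fun x y ↦ by
    rw [LinearMap.smul_apply, LinearMap.smul_apply, LinearMap.map_smul₂, map_smul, isAdjointPair_poincareTranspose]

/-- **`ᵗ(uv) = ᵗv ᵗu`**: transposition is ANTI-MULTIPLICATIVE. [cite: BourbakiAlgebraI1989, Ch. III §9] [cite: Andre1996Motifs, Prop. 3.3 (p. 21)] -/
theorem poincareTranspose_mul (e : Fin N ≃ ι) (S T : Module.End ℂ (GForm E ℂ)) :
    poincareTranspose Φ e (S * T) = poincareTranspose Φ e T * poincareTranspose Φ e S :=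
  poincareTranspose_eq_of_isAdjointPair Φ e ((isAdjointPair_poincareTranspose Φ e S).mul (isAdjointPair_poincareTranspose Φ e T))

/-- **`ᵗᵗu = u` for `u` commuting with the Weil operator** (row g52-#3: such transposes are two-sided). [cite: Andre1996Motifs, Prop. 2.3, Prop. 3.3 (p. 21)]
[cite: BourbakiAlgebraI1989, Ch. III §9] -/
theorem poincareTranspose_poincareTranspose (e : Fin N ≃ ι) {T : Module.End ℂ (GForm E ℂ)} (hC : Commute (rotG E (Real.pi / 2)) T) :
    poincareTranspose Φ e (poincareTranspose Φ e T) = T :=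
  poincareTranspose_eq_of_isAdjointPair Φ e (isAdjointPair_comm_of_commute_rotG_pi_div_two Φ e (isAdjointPair_poincareTranspose Φ e T) hC)

/-- **`ᵗ(e^{iθ})^* = (e^{−iθ})^*`** (in particular `ᵗC = C⁻¹`). [cite: Andre1996Motifs, §1.1 (p. 11)] -/
theorem poincareTranspose_rotG (e : Fin N ≃ ι) (θ : ℝ) : poincareTranspose Φ e (rotG E θ) = rotG E (-θ) :=
  poincareTranspose_eq_of_isAdjointPair Φ e (isAdjointPair_poincarePairingG_rotG Φ e θ)

/-- **`ᵗL_η = L_η`** ("`L` […] auto-adjoint"). [cite: Andre1996Motifs, §1.1 (p. 11)] -/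
theorem poincareTranspose_lefschetzG (e : Fin N ≃ ι) (η : E [⋀^Fin 2]→L[ℝ] ℝ) : poincareTranspose Φ e (lefschetzG η) = lefschetzG η :=
  poincareTranspose_eq_of_isAdjointPair Φ e (isSelfAdjoint_poincarePairingG_lefschetzG Φ η e)

/-- **`ᵗu` is real for `u` real.** [cite: Andre1996Motifs, Prop. 3.3 (proof, p. 22)] -/
theorem conjG_poincareTranspose_apply (e : Fin N ≃ ι) {T : Module.End ℂ (GForm E ℂ)} (hT : ∀ x, GForm.conjG (T x) = T (GForm.conjG x)) (y : GForm E ℂ) :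
    GForm.conjG (poincareTranspose Φ e T y) = poincareTranspose Φ e T (GForm.conjG y) :=
  conjG_apply_of_isAdjointPair_poincarePairingG Φ e (isAdjointPair_poincareTranspose Φ e T) hT y

/-- **`[C, ᵗu] = 0` for `[C, u] = 0`** ("stable par transposition"). [cite: Andre1996Motifs, Prop. 2.3 (p. 16)] -/
theorem commute_rotG_pi_div_two_poincareTranspose (e : Fin N ≃ ι) {T : Module.End ℂ (GForm E ℂ)} (hC : Commute (rotG E (Real.pi / 2)) T) :
    Commute (rotG E (Real.pi / 2)) (poincareTranspose Φ e T) :=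
  commute_rotG_pi_div_two_of_isAdjointPair Φ e (isAdjointPair_poincareTranspose Φ e T) hC

/-- **`Tr ᵗu = Tr u`.** [cite: BourbakiAlgebraI1989, Ch. II §4 no. 3] -/
theorem trace_poincareTranspose (e : Fin N ≃ ι) (T : Module.End ℂ (GForm E ℂ)) :
    LinearMap.trace ℂ (GForm E ℂ) (poincareTranspose Φ e T) = LinearMap.trace ℂ (GForm E ℂ) T :=
  trace_eq_of_isAdjointPair_poincarePairingG Φ e (isAdjointPair_poincareTranspose Φ e T)

end Transpose

/-! ## §1b Transposes of the Lefschetz operators attached to a non-degenerate `η` -/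

section TransposeLefschetz

variable [Nontrivial E] (hη : ∀ v : E, v ≠ 0 → ∃ w : E, η ![v, w] ≠ 0)

include hη in
/-- **`ᵗΛ_η = Λ_η`** ("`ᶜΛ` […] auto-adjoint"). [cite: Andre1996Motifs, §1.1 (p. 11)] -/
theorem poincareTranspose_lefschetzDualG (e : Fin N ≃ ι) : poincareTranspose Φ e (lefschetzDualG η) = lefschetzDualG η :=
  poincareTranspose_eq_of_isAdjointPair Φ e (isSelfAdjoint_poincarePairingG_lefschetzDualG Φ hη e)

/-- **`ᵗw = w`** for the Weyl operator. [cite: Andre1996Motifs, §1.2 (p. 11)] -/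
theorem poincareTranspose_weylOperator (e : Fin N ≃ ι) :
    poincareTranspose Φ e ((hasLefschetzProperty_lefschetzG hη).weylOperator isZGrading_countingG) =
      (hasLefschetzProperty_lefschetzG hη).weylOperator isZGrading_countingG :=
  poincareTranspose_eq_of_isAdjointPair Φ e (isSelfAdjoint_poincarePairingG_weylOperator Φ hη e)

/-- **`ᵗ*_H = *_H`** ("`*_H` […] auto-adjoint"). [cite: Andre1996Motifs, §1.1 (p. 11)] -/
theorem poincareTranspose_andreHodgeInvolution (e : Fin N ≃ ι) (d : ℕ) :
    poincareTranspose Φ e ((hasLefschetzProperty_lefschetzG hη).andreHodgeInvolution isZGrading_countingG d) =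
      (hasLefschetzProperty_lefschetzG hη).andreHodgeInvolution isZGrading_countingG d :=
  poincareTranspose_eq_of_isAdjointPair Φ e (isSelfAdjoint_poincarePairingG_andreHodgeInvolution Φ hη e d)

end TransposeLefschetz

/-! ## §2 André's involution `u† = u′ = *_H ᵗu *_H` as an operation (`andreDagger`; the name `andreStar` is taken by p34's `*_H` on `⋀ W`) -/

section Star

variable [Nontrivial E] (hη : ∀ v : E, v ≠ 0 → ∃ w : E, η ![v, w] ≠ 0)

/-- **André's involution `u† = u′ := *_H ᵗu *_H`** of an operator `u` on `H•(X; ℂ)` (`*_H` with the normalisation `d = g`): the involution "`′`" of Prop. 3.3 / Remarque 1, acting on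
`End H•(X)` "par transport de structure"; Kleiman's `u ↦ u'`. [cite: Andre1996Motifs, Prop. 3.3 (p. 21), Appendice Remarque 1 (p. 47)] [cite: Kleiman1968AlgebraicCycles, §3 Thm. 3.11] -/
def andreDagger (e : Fin N ≃ ι) (T : Module.End ℂ (GForm E ℂ)) : Module.End ℂ (GForm E ℂ) :=
  (hasLefschetzProperty_lefschetzG hη).andreHodgeInvolution isZGrading_countingG (finrank ℂ E) * poincareTranspose Φ e T *
    (hasLefschetzProperty_lefschetzG hη).andreHodgeInvolution isZGrading_countingG (finrank ℂ E)

/-- Unfolding: `u′ = *_H ᵗu *_H`. [cite: Andre1996Motifs, Prop. 3.3 (p. 21)] -/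
theorem andreDagger_def (e : Fin N ≃ ι) (T : Module.End ℂ (GForm E ℂ)) :
    andreDagger Φ hη e T = (hasLefschetzProperty_lefschetzG hη).andreHodgeInvolution isZGrading_countingG (finrank ℂ E) * poincareTranspose Φ e T *
      (hasLefschetzProperty_lefschetzG hη).andreHodgeInvolution isZGrading_countingG (finrank ℂ E) := rfl

/-- `1′ = 1` (`*_H² = 1`). [cite: Andre1996Motifs, §1.1 (p. 10: "involutions de Lefschetz et de Hodge")] -/
theorem andreDagger_one (e : Fin N ≃ ι) : andreDagger Φ hη e 1 = 1 := by
  rw [andreDagger_def, poincareTranspose_one, mul_one, (hasLefschetzProperty_lefschetzG hη).andreHodgeInvolution_mul_self]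

/-- `0′ = 0`. [cite: Andre1996Motifs, Prop. 3.3 (p. 21)] -/
theorem andreDagger_zero (e : Fin N ≃ ι) : andreDagger Φ hη e 0 = 0 := by
  rw [andreDagger_def, poincareTranspose_zero, mul_zero, zero_mul]

/-- `(u + v)′ = u′ + v′`. [cite: Andre1996Motifs, Prop. 3.3 (p. 21)] -/
theorem andreDagger_add (e : Fin N ≃ ι) (S T : Module.End ℂ (GForm E ℂ)) : andreDagger Φ hη e (S + T) = andreDagger Φ hη e S + andreDagger Φ hη e T := by
  rw [andreDagger_def, andreDagger_def, andreDagger_def, poincareTranspose_add, mul_add, add_mul]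

/-- `(c u)′ = c u′`. [cite: Andre1996Motifs, Prop. 3.3 (p. 21)] -/
theorem andreDagger_smul (e : Fin N ≃ ι) (c : ℂ) (T : Module.End ℂ (GForm E ℂ)) : andreDagger Φ hη e (c • T) = c • andreDagger Φ hη e T := by
  rw [andreDagger_def, andreDagger_def, poincareTranspose_smul, mul_smul_comm, smul_mul_assoc]

/-- **`(uv)′ = v′ u′`**: André's star is ANTI-MULTIPLICATIVE (`ᵗ(uv) = ᵗv ᵗu`, `*_H² = 1`). [cite: Andre1996Motifs, Prop. 3.3 (p. 21), Appendice Remarque 1 (p. 47)] -/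
theorem andreDagger_mul (e : Fin N ≃ ι) (S T : Module.End ℂ (GForm E ℂ)) : andreDagger Φ hη e (S * T) = andreDagger Φ hη e T * andreDagger Φ hη e S := by
  rw [andreDagger_def, andreDagger_def, andreDagger_def, poincareTranspose_mul, andreAdjoint_mul hη]

/-- **`u″ = u` for `u` commuting with the Weil operator**: André's star is an INVOLUTION on the `C`-commuting operators (`ᵗ(*_H ᵗu *_H) = *_H u *_H`, row g52-#3, and `*_H² = 1`).
[cite: Andre1996Motifs, Prop. 3.3 (p. 21), Appendice Remarque 1 (p. 47)] [cite: Kleiman1968AlgebraicCycles, §3 Thm. 3.11] -/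
theorem andreDagger_andreDagger (e : Fin N ≃ ι) {T : Module.End ℂ (GForm E ℂ)} (hC : Commute (rotG E (Real.pi / 2)) T) :
    andreDagger Φ hη e (andreDagger Φ hη e T) = T := by
  rw [andreDagger_def, andreDagger_def, poincareTranspose_eq_of_isAdjointPair Φ e
    (isAdjointPair_poincarePairingG_andreAdjoint Φ hη e (isAdjointPair_poincareTranspose Φ e T) hC), andreAdjoint_andreAdjoint hη]

/-- **`L_η′ = Λ_η`**: `ᵗL_η = L_η` and "`*_H L *_H = ᶜΛ`". [cite: Andre1996Motifs, §1.1 (pp. 10–11)] -/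
theorem andreDagger_lefschetzG (e : Fin N ≃ ι) : andreDagger Φ hη e (lefschetzG η) = lefschetzDualG η := by
  rw [andreDagger_def, poincareTranspose_lefschetzG, andreHodgeInvolution_mul_lefschetzG_mul_andreHodgeInvolution hη]

/-- **`Λ_η′ = L_η`** (`ᵗΛ_η = Λ_η`, `*_H Λ_η *_H = L_η`). [cite: Andre1996Motifs, §1.1 (pp. 10–11)] -/
theorem andreDagger_lefschetzDualG (e : Fin N ≃ ι) : andreDagger Φ hη e (lefschetzDualG η) = lefschetzG η := by
  have h := andreHodgeInvolution_mul_lefschetzG_mul_andreHodgeInvolution hη (finrank ℂ E)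
  have hss := (hasLefschetzProperty_lefschetzG hη).andreHodgeInvolution_mul_self isZGrading_countingG (finrank ℂ E)
  rw [andreDagger_def, poincareTranspose_lefschetzDualG Φ hη e, ← h, ← mul_assoc, ← mul_assoc, hss, one_mul, mul_assoc, hss, mul_one]

/-- **`*_H′ = *_H`.** [cite: Andre1996Motifs, §1.1 (pp. 10–11)] -/
theorem andreDagger_andreHodgeInvolution (e : Fin N ≃ ι) :
    andreDagger Φ hη e ((hasLefschetzProperty_lefschetzG hη).andreHodgeInvolution isZGrading_countingG (finrank ℂ E)) =
      (hasLefschetzProperty_lefschetzG hη).andreHodgeInvolution isZGrading_countingG (finrank ℂ E) := by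
  rw [andreDagger_def, poincareTranspose_andreHodgeInvolution Φ hη e, (hasLefschetzProperty_lefschetzG hη).andreHodgeInvolution_mul_self, one_mul]

/-- **`u′` is real for `u` real.** [cite: Andre1996Motifs, Prop. 3.3 (proof, p. 22)] -/
theorem conjG_andreDagger_apply (e : Fin N ≃ ι) {T : Module.End ℂ (GForm E ℂ)} (hT : ∀ x, GForm.conjG (T x) = T (GForm.conjG x)) (x : GForm E ℂ) :
    GForm.conjG (andreDagger Φ hη e T x) = andreDagger Φ hη e T (GForm.conjG x) :=
  conjG_andreAdjoint_apply Φ hη e (isAdjointPair_poincareTranspose Φ e T) hT x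

/-- **`[C, u′] = 0` for `[C, u] = 0`** (`η` of type `(1,1)`): the `C`-commuting operators are stable under `′`. [cite: Andre1996Motifs, Prop. 2.3 (p. 16), Prop. 3.3 (p. 21)] -/
theorem commute_rotG_pi_div_two_andreDagger (h11 : ∀ u v : E, η ![Complex.I • u, Complex.I • v] = η ![u, v]) (hη : ∀ v : E, v ≠ 0 → ∃ w : E, η ![v, w] ≠ 0)
    (e : Fin N ≃ ι) {T : Module.End ℂ (GForm E ℂ)} (hC : Commute (rotG E (Real.pi / 2)) T) : Commute (rotG E (Real.pi / 2)) (andreDagger Φ hη e T) :=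
  commute_rotG_pi_div_two_andreAdjoint Φ h11 hη e (isAdjointPair_poincareTranspose Φ e T) hC

/-- **`Tr u′ = Tr u`.** [cite: Andre1996Motifs, Prop. 3.3 (p. 21)] -/
theorem trace_andreDagger (e : Fin N ≃ ι) (T : Module.End ℂ (GForm E ℂ)) :
    LinearMap.trace ℂ (GForm E ℂ) (andreDagger Φ hη e T) = LinearMap.trace ℂ (GForm E ℂ) T :=
  trace_andreAdjoint Φ hη e (isAdjointPair_poincareTranspose Φ e T)

end Star

/-! ## §3 Adjunction, positivity and symmetry of the trace form, read with `andreDagger` -/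

section Positivity

variable [Nontrivial E] (hη : ∀ v : E, v ≠ 0 → ∃ w : E, η ![v, w] ≠ 0)

/-- **`⟨u′ x, y⟩_H = ⟨x, u y⟩_H`** for `u` real commuting with the Weil operator: André's star is the adjunction of the Hodge metric (row g52-#2, with `ᵗu := poincareTranspose`).
[cite: Andre1996Motifs, Prop. 3.3 (p. 21) and its proof (p. 22)] -/
theorem andreHodgeMetric_andreDagger_left (e : Fin N ≃ ι) {T : Module.End ℂ (GForm E ℂ)} (hC : Commute (rotG E (Real.pi / 2)) T)
    (hT : ∀ x, GForm.conjG (T x) = T (GForm.conjG x)) (x y : GForm E ℂ) :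
    andreHodgeMetric Φ hη e (andreDagger Φ hη e T x) y = andreHodgeMetric Φ hη e x (T y) :=
  andreHodgeMetric_andreAdjoint_left Φ hη e (isAdjointPair_poincareTranspose Φ e T) hC hT x y

/-- **`⟨x, u′ y⟩_H = ⟨u x, y⟩_H`** (`η` a Kähler datum, `e : Fin (2g) ≃ ι`). [cite: Andre1996Motifs, Prop. 3.3 (p. 21)] -/
theorem andreHodgeMetric_andreDagger_right (h11 : ∀ u v : E, η ![Complex.I • u, Complex.I • v] = η ![u, v]) (hpos : ∀ u : E, u ≠ 0 → 0 < η ![Complex.I • u, u])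
    (hη : ∀ v : E, v ≠ 0 → ∃ w : E, η ![v, w] ≠ 0) {g : ℕ} (e : Fin (2 * g) ≃ ι) {T : Module.End ℂ (GForm E ℂ)} (hC : Commute (rotG E (Real.pi / 2)) T)
    (hT : ∀ x, GForm.conjG (T x) = T (GForm.conjG x)) (x y : GForm E ℂ) :
    andreHodgeMetric Φ hη e x (andreDagger Φ hη e T y) = andreHodgeMetric Φ hη e (T x) y :=
  andreHodgeMetric_andreAdjoint_right Φ h11 hpos hη e (isAdjointPair_poincareTranspose Φ e T) hC hT x y

/-- **`Tr(u ∘ u′) = c > 0` for every non-zero real operator `u` commuting with the Weil operator** (`η` a Kähler datum) — André Prop. 3.3 / Kleiman Thm. 3.11 on the torus, read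
with `u′ = andreDagger u`. [cite: Andre1996Motifs, Prop. 3.3 (p. 21)] [cite: Kleiman1968AlgebraicCycles, §3 Thm. 3.11] -/
theorem exists_pos_trace_mul_andreDagger (h11 : ∀ u v : E, η ![Complex.I • u, Complex.I • v] = η ![u, v]) (hpos : ∀ u : E, u ≠ 0 → 0 < η ![Complex.I • u, u])
    (hη : ∀ v : E, v ≠ 0 → ∃ w : E, η ![v, w] ≠ 0) {g : ℕ} (e : Fin (2 * g) ≃ ι) {T : Module.End ℂ (GForm E ℂ)} (hC : Commute (rotG E (Real.pi / 2)) T)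
    (hT : ∀ x, GForm.conjG (T x) = T (GForm.conjG x)) (h0 : T ≠ 0) :
    ∃ c : ℝ, 0 < c ∧ LinearMap.trace ℂ (GForm E ℂ) (T * andreDagger Φ hη e T) = c :=
  exists_pos_trace_mul_andreAdjoint Φ h11 hpos hη e (isAdjointPair_poincareTranspose Φ e T) hC hT h0

/-- **`Tr(u ∘ u′) = 0 ↔ u = 0`** for real `u` commuting with the Weil operator (`η` a Kähler datum). [cite: Andre1996Motifs, Prop. 3.3 (p. 21)] -/
theorem trace_mul_andreDagger_eq_zero_iff (h11 : ∀ u v : E, η ![Complex.I • u, Complex.I • v] = η ![u, v]) (hpos : ∀ u : E, u ≠ 0 → 0 < η ![Complex.I • u, u])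
    (hη : ∀ v : E, v ≠ 0 → ∃ w : E, η ![v, w] ≠ 0) {g : ℕ} (e : Fin (2 * g) ≃ ι) {T : Module.End ℂ (GForm E ℂ)} (hC : Commute (rotG E (Real.pi / 2)) T)
    (hT : ∀ x, GForm.conjG (T x) = T (GForm.conjG x)) :
    LinearMap.trace ℂ (GForm E ℂ) (T * andreDagger Φ hη e T) = 0 ↔ T = 0 :=
  trace_mul_andreAdjoint_eq_zero_iff Φ h11 hpos hη e (isAdjointPair_poincareTranspose Φ e T) hC hT

/-- **`Tr(u ∘ v′) = Tr(v ∘ u′)`** for `v` commuting with the Weil operator — the trace form is symmetric. [cite: Andre1996Motifs, Prop. 3.3 (p. 21)] -/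
theorem trace_mul_andreDagger_comm (e : Fin N ≃ ι) (S : Module.End ℂ (GForm E ℂ)) {T : Module.End ℂ (GForm E ℂ)} (hC : Commute (rotG E (Real.pi / 2)) T) :
    LinearMap.trace ℂ (GForm E ℂ) (S * andreDagger Φ hη e T) = LinearMap.trace ℂ (GForm E ℂ) (T * andreDagger Φ hη e S) :=
  trace_mul_andreAdjoint_comm Φ hη e (isAdjointPair_poincareTranspose Φ e S) (isAdjointPair_poincareTranspose Φ e T) hC

/-- **`Tr(u ∘ v′) ∈ ℝ`** for real `u`, `v` commuting with the Weil operator (`η` a Kähler datum). [cite: Andre1996Motifs, Prop. 3.3 (p. 21)] -/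
theorem conj_trace_mul_andreDagger_self (h11 : ∀ u v : E, η ![Complex.I • u, Complex.I • v] = η ![u, v]) (hpos : ∀ u : E, u ≠ 0 → 0 < η ![Complex.I • u, u])
    (hη : ∀ v : E, v ≠ 0 → ∃ w : E, η ![v, w] ≠ 0) {g : ℕ} (e : Fin (2 * g) ≃ ι) {S T : Module.End ℂ (GForm E ℂ)} (hSC : Commute (rotG E (Real.pi / 2)) S)
    (hSr : ∀ x, GForm.conjG (S x) = S (GForm.conjG x)) (hTC : Commute (rotG E (Real.pi / 2)) T) (hTr : ∀ x, GForm.conjG (T x) = T (GForm.conjG x)) :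
    starRingEnd ℂ (LinearMap.trace ℂ (GForm E ℂ) (S * andreDagger Φ hη e T)) = LinearMap.trace ℂ (GForm E ℂ) (S * andreDagger Φ hη e T) :=
  conj_trace_mul_andreAdjoint_self Φ h11 hpos hη e (isAdjointPair_poincareTranspose Φ e S) hSC hSr (isAdjointPair_poincareTranspose Φ e T) hTC hTr

end Positivity

end ComplexTorus

end Literature.Geometry.Kaehler
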